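import Mathlib
import Summits.MatrixMultiplication.MatrixMultiplication.Theorems.HiddenToeplitzCornersHiddenCornerLemmaRSmallD
import Summits.MatrixMultiplication.MatrixMultiplication.Theorems.HiddenToeplitzCornersHiddenCornerLemmaRPhiInjReduction

/-!
# `HiddenCornerLemmaR` for displacement rank `d ≤ 2` from the single conjecture PHI-INJ₃'

Assembly for crux item `stmt-MatrixMultiplication-10752`, line `frobenius-dual-short-syzygies`: composes the landed
`hclR_gconstDualLaw_p_two_of_phiInj3` (PHI-INJ₃' ⟹ the G-constant law at `p = 2`) with the landed
`hclR_HiddenCornerLemmaR_d_le_two_of_p_two` (that law ⟹ the hidden-corner lemma for `d ≤ 2`).  PHI-INJ₃' is the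
statement that a nonsingular 3-column hidden-corner design of a 2-generator class has jointly surjective twisted
evaluation maps (equivalently: only the trivial class kernel); it is verified in every computed design
(math/STRIP_THEOREM.md §11) and proved on paper for balanced shapes (§13).
-/

set_option linter.dupNamespace false

namespace Summit.MatrixMultiplication.MatrixMultiplication.Theorems

open scoped Matrix

/-- **`HiddenCornerLemmaR` for `d ≤ 2`, conditionally on PHI-INJ₃'.** -/
theorem hclR_HiddenCornerLemmaR_d_le_two_of_phiInj3 : (∀ (N : ℕ) (G₀ : Matrix (Fin N) (Fin 2) ℂ) (E F : Matrix (Fin N) (Fin 3) ℂ) (M : Matrix (Fin N) (Fin N) ℂ) (H : Matrix (Fin N) (Fin 2) ℂ) (X₀ : Matrix (Fin 3) (Fin 3) ℂ), E.rank = 3 → F.rank = 3 → (∀ Λ : Matrix (Fin N) (Fin 3) ℂ, (∀ k : Fin 2, (∑ c : Fin 3, (∑ j : Fin N, (((∑ i : Fin N, G₀ i k • (Matrix.of fun i j : Fin N => if (i : ℕ) = (j : ℕ) + 1 then (1 : ℂ) else 0)ᵀ ^ (i : ℕ)) *ᵥ (Λᵀ c)) j) • (Matrix.of fun i j : Fin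 N => if (i : ℕ) = (j : ℕ) + 1 then (1 : ℂ) else 0)ᵀ ^ (j : ℕ)) *ᵥ (Eᵀ c)) = 0) → Λᵀ * F = 0) → M - (Matrix.of fun i j : Fin N => if (i : ℕ) = (j : ℕ) + 1 then (1 : ℂ) else 0) * M * (Matrix.of fun i j : Fin N => if (i : ℕ) = (j : ℕ) + 1 then (1 : ℂ) else 0)ᵀ = G₀ * Hᵀ → M * E = F * X₀ → M.det ≠ 0 → ∀ v : Fin N → ℂ, v ∈ Submodule.span ℂ {w : Fin N → ℂ | ∃ (c : Fin 3) (j : ℕ), w = ((Matrix.of fun i j : Fin N => if (i : ℕ) = (j : ℕ) + 1 then (1 : ℂ) else 0)ᵀ ^ j) *ᵥ (Eᵀ c)} → ∀ μ : Fin N → ℂ, ∃ Λ : Matrix (Fin N) (Fin 3) ℂ, ∀ k : Fin 2, (∑ c : Fin 3, (∑ j : Fin N, (((∑ i : Fin N, G₀ i k • (Matrix.of fun i j : Fin N => if (i : ℕ) = (j : ℕ) + 1 then (1 : ℂ) else 0)ᵀ ^ (i : ℕ)) *ᵥ (Λᵀ c)) j) • (Matrix.of fun i j : Fin N => if (i :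 ℕ) = (j : ℕ) + 1 then (1 : ℂ) else 0)ᵀ ^ (j : ℕ)) *ᵥ (Eᵀ c)) = (∑ j : Fin N, (((∑ i : Fin N, G₀ i k • (Matrix.of fun i j : Fin N => if (i : ℕ) = (j : ℕ) + 1 then (1 : ℂ) else 0)ᵀ ^ (i : ℕ)) *ᵥ μ) j) • (Matrix.of fun i j : Fin N => if (i : ℕ) = (j : ℕ) + 1 then (1 : ℂ) else 0)ᵀ ^ (j : ℕ)) *ᵥ v) → ∀ (r N d : ℕ) (T : Fin r → Fin r → Matrix (Fin N) (Fin N) ℂ) (E F : Matrix (Fin N) (Fin r) ℂ), d ≤ 2 → E.rank = r → F.rank = r → (∀ X : Matrix (Fin r) (Fin r) ℂ, (∑ a : Fin r, ∑ b : Fin r, X a b • T a b) * E = F * X) → (∀ X : Matrix (Fin r) (Fin r) ℂ, ((∑ a : Fin r, ∑ b : Fin r, X a b • T a b) - (Matrix.of fun i j : Fin N => if (i : ℕ) = (j : ℕ) + 1 then (1 : ℂ) else 0) * (∑ a : Fin r, ∑ b : Fin r, X a b • T a b) * (Matrix.of fun i j : Fin N => if (i : ℕ) = (j : ℕ) + 1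 then (1 : ℂ) else 0)ᵀ).rank ≤ d) → (∃ X₀ : Matrix (Fin r) (Fin r) ℂ, (∑ a : Fin r, ∑ b : Fin r, X₀ a b • T a b).det ≠ 0) → r ≤ 2 * d := by
  intro hPHI
  exact hclR_HiddenCornerLemmaR_d_le_two_of_p_two (hclR_gconstDualLaw_p_two_of_phiInj3 hPHI)

end Summit.MatrixMultiplication.MatrixMultiplication.Theorems
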